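import Literature.LinearAlgebra.Alternating.GradedForms
import Literature.NumberTheory.Transcendental.FormsAlgebraWedgeAssocProofs
import Literature.NumberTheory.Transcendental.FormsAlgebraWedgeCommProofs
import Mathlib.Algebra.BigOperators.NatAntidiagonal
import Mathlib.Algebra.BigOperators.Fin
import Mathlib.Algebra.Algebra.Defs
import HarnessLib

/-!
# The ring of graded forms and the iterated Leibniz rule for antiderivations

Topic `Literature/LinearAlgebra/Alternating`, sequel of `GradedForms.lean`. For a real normed space `V`
and a normed commutative `ℝ`-algebra `A`, the graded forms `GForm V A = Π_m (V [⋀^Fin m]→L[ℝ] A)` carry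
the shuffle wedge `wedgeG` (`GradedForms.lean`: bilinear, `wedgeG_of_of`). Here we make
`GForm V A` a **ring** (indeed an `ℝ`-algebra) under `wedgeG`, with unit the constant `0`-form `1`
(Warner (1983), 2.6: "`∧` is bilinear and associative", 2.10), so that products of any number of forms
of any degrees are the honest `List.prod` of the ring and the identities of the exterior algebra can be
manipulated with `mul_assoc` / `Finset.mul_sum` instead of transports along equations of degrees:

* `GForm.instRing : Ring (GForm V A)` with `w * w' = wedgeG w w'`, `1 = of 0 1`; associativity
  `wedgeG_assoc` is `ContinuousAlternatingMap.WedgeAssoc_holds` summed over the antidiagonals (the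
  re-indexation of `MvPowerSeries.mul_assoc`), the unit laws are `constOfIsEmpty_one_wedge` and graded
  commutativity; `GForm.instAlgebra : Algebra ℝ (GForm V A)`, `GForm.instAlgebraComplex : Algebra ℂ (GForm V ℂ)`;
* `of_mul_of : of k η * of l ψ = of (k + l) (η ∧ ψ)`; **graded commutativity**
  `of_mul_of_comm : of l ψ * of k η = (-1)^{kl} • (of k η * of l ψ)` (`WedgeComm_holds`) and, against an
  ARBITRARY graded form `z`, `of_mul_eq_twist_mul_of : of k η * z = z^{(k)} * of k η` with
  `z^{(k)}_m = (-1)^{km} z_m`; hence **homogeneous elements of even degree are central**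
  (`of_mul_comm_of_even`, `IsHomog.mul_comm_of_even`) and those of odd degree anticommute in the graded
  sense (`of_mul_eq_negDeg_mul_of_odd`);
* the parity operator `negDeg` is a ring automorphism (`negDeg_mul`, `negDegRingHom`);
  `IsHomog.mul`, `IsHomog.list_prod` (degrees add along products);
* **the iterated Leibniz rule.** Call a map `D : GForm V A → GForm V A` an *antiderivation* when
  `D (w * w') = D w * w' + negDeg w * D w'` (Warner (1983), 2.11: the interior products `x ⌟ ·` and the
  exterior derivative are antiderivations). Then `D 1 = 0` (`apply_one_of_leibniz`) and, for a product
  of any number of factors `w₁ ⋯ w_r = (l.map f).prod` along an index list `l`,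
  `apply_list_prod_of_leibniz : D (w₁ ⋯ w_r) = Σ_i negDeg (w₁ ⋯ w_{i-1}) * D w_i * (w_{i+1} ⋯ w_r)`
  (also under the weaker hypothesis that the rule holds on homogeneous factors,
  `apply_list_prod_of_leibniz_of_isHomog`), and for homogeneous factors of EVEN degrees — which are
  central and fixed by `negDeg` — the sign-free form
  `apply_list_prod_of_leibniz_of_even : D (w₁ ⋯ w_r) = Σ_i (w₁ ⋯ w̌_i ⋯ w_r) * D w_i`
  (`List.eraseIdx`), the shape of the product rule used for intersection products of algebraic cycles
  (Lange 2023, Lemma 4.6.9, file `Geometry/Kaehler/ComplexTorusCycleEndomorphismsProductRule.lean`).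

Everything is a definition with a body (the instances) or a proved identity; no named facts.

## References

* F. W. Warner, *Foundations of Differentiable Manifolds and Lie Groups*, GTM 94 (1983), 2.6
  (the exterior algebra: bilinear, associative, graded-commutative wedge), 2.10, 2.11 (antiderivations).
  [Warner1983]
* H. Lange, *Abelian Varieties over the Complex Numbers*, Grundlehren Text Editions, Springer (2023),
  §4.6.2 Lemma 4.6.9 (the product rule this file abstracts). [Lange2023AbelianVarietiesComplex]
-/

noncomputable section

open ContinuousAlternatingMap Function Finset
open Literature.Geometry.Kaehler (domDomCongr_finCongr_trans domDomCongr_finCongr_self sum_wedge_left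
  domDomCongr_sum)

namespace Literature.LinearAlgebra.Alternating

variable {V : Type*} [NormedAddCommGroup V] [NormedSpace ℝ V]
  {A : Type*} [NormedCommRing A] [NormedAlgebra ℝ A]

namespace GForm

/-! ### Small helpers: `dite` and sums through `∧` and reindexing -/

section Helpers

variable {F : Type*} [NormedAddCommGroup F] [NormedSpace ℝ F] {k l : ℕ}

/-- A `dite` with zero alternative passes through the left factor of a wedge. [folklore] -/
private theorem dite_wedge {p : Prop} [Decidable p] (α : p → V [⋀^Fin k]→L[ℝ] A)
    (γ : V [⋀^Fin l]→L[ℝ] A) :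
    (if h : p then α h else 0).wedge γ = if h : p then (α h).wedge γ else 0 := by
  split_ifs
  · rfl
  · exact zero_wedge γ

/-- A `dite` with zero alternative passes through the right factor of a wedge. [folklore] -/
private theorem wedge_dite {p : Prop} [Decidable p] (γ : V [⋀^Fin k]→L[ℝ] A)
    (α : p → V [⋀^Fin l]→L[ℝ] A) :
    γ.wedge (if h : p then α h else 0) = if h : p then γ.wedge (α h) else 0 := by
  split_ifs
  · rfl
  · exact wedge_zero γ

/-- A `dite` with zero alternative passes through a reindexing. [folklore] -/
private theorem dite_domDomCongr {p : Prop} [Decidable p] {ι₁ ι₂ : Type*} (σ : ι₁ ≃ ι₂)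
    (α : p → V [⋀^ι₁]→L[ℝ] F) :
    (if h : p then α h else 0).domDomCongr σ = if h : p then (α h).domDomCongr σ else 0 := by
  split_ifs
  · rfl
  · exact ContinuousAlternatingMap.domDomCongr_zero σ

/-- `γ ∧ (∑ᵢ αᵢ) = ∑ᵢ γ ∧ αᵢ`. [folklore] -/
private theorem wedge_finset_sum {κ : Type*} (s : Finset κ) (γ : V [⋀^Fin k]→L[ℝ] A)
    (α : κ → V [⋀^Fin l]→L[ℝ] A) : γ.wedge (∑ i ∈ s, α i) = ∑ i ∈ s, γ.wedge (α i) := by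
  classical
  induction s using Finset.induction_on with
  | empty => rw [sum_empty, sum_empty, wedge_zero]
  | insert a s ha ih => rw [sum_insert ha, sum_insert ha, ContinuousAlternatingMap.wedge_add_right, ih]

end Helpers

/-! ### Multiplication and unit -/

/-- The unit graded form: the constant `0`-form `1`. [cite: Warner1983, 2.6] -/
instance instOne : One (GForm V A) := ⟨of 0 (ContinuousAlternatingMap.constOfIsEmpty ℝ V (Fin 0) (1 : A))⟩

/-- Multiplication of graded forms is the shuffle wedge `wedgeG`. [cite: Warner1983, 2.6 / 2.10] -/
instance instMul : Mul (GForm V A) := ⟨wedgeG⟩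

/-- `1 = of 0 1`. [cite: Warner1983, 2.6] -/
theorem one_def : (1 : GForm V A) = of 0 (ContinuousAlternatingMap.constOfIsEmpty ℝ V (Fin 0) (1 : A)) :=
  rfl

/-- `w * w' = wedgeG w w'`. [cite: Warner1983, 2.6 / 2.10] -/
theorem mul_def (w w' : GForm V A) : w * w' = wedgeG w w' := rfl

/-- Components of a product: `(w * w')_n = ∑_{p + q = n} w_p ∧ w'_q`. [cite: Warner1983, 2.10] -/
theorem mul_apply (w w' : GForm V A) (n : ℕ) :
    (w * w') n = ∑ p ∈ antidiagonal n,
      if h : p.1 + p.2 = n then ((w p.1).wedge (w' p.2)).domDomCongr (finCongr h) else 0 := rfl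

/-- **The product of homogeneous elements**: `of k η * of l ψ = of (k + l) (η ∧ ψ)`. [cite: Warner1983, 2.6] -/
theorem of_mul_of (k l : ℕ) (η : V [⋀^Fin k]→L[ℝ] A) (ψ : V [⋀^Fin l]→L[ℝ] A) :
    of k η * of l ψ = of (k + l) (η.wedge ψ) :=
  wedgeG_of_of k l η ψ

/-- **Associativity of the shuffle wedge of graded forms** (Warner (1983), 2.6), from the associativity
of `∧` in each triple of degrees (`ContinuousAlternatingMap.WedgeAssoc_holds`) by re-indexing the double
sums over antidiagonals `∑_{p + c = n} ∑_{a + b = p} = ∑_{a + q = n} ∑_{b + c = q}`.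
[cite: Warner1983, 2.6] -/
theorem wedgeG_assoc (w w' w'' : GForm V A) :
    wedgeG (wedgeG w w') w'' = wedgeG w (wedgeG w' w'') := by
  funext n
  rw [wedgeG_apply, wedgeG_apply]
  -- expand the inner products, keeping the outer `dite` innermost
  have hL : ∀ x ∈ antidiagonal n,
      (if h : x.1 + x.2 = n then ((wedgeG w w' x.1).wedge (w'' x.2)).domDomCongr (finCongr h) else 0) =
        ∑ y ∈ antidiagonal x.1, (if h : x.1 + x.2 = n then
          (if h' : y.1 + y.2 = x.1 then ((((w y.1).wedge (w' y.2)).domDomCongr (finCongr h')).wedge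
            (w'' x.2)).domDomCongr (finCongr h) else 0) else 0) := by
    intro x hx
    have h : x.1 + x.2 = n := mem_antidiagonal.1 hx
    simp only [dif_pos h, wedgeG_apply, sum_wedge_left, domDomCongr_sum, dite_wedge, dite_domDomCongr]
  have hR : ∀ x ∈ antidiagonal n,
      (if h : x.1 + x.2 = n then ((w x.1).wedge (wedgeG w' w'' x.2)).domDomCongr (finCongr h) else 0) =
        ∑ y ∈ antidiagonal x.2, (if h : x.1 + x.2 = n then
          (if h' : y.1 + y.2 = x.2 then ((w x.1).wedge (((w' y.1).wedge (w'' y.2)).domDomCongr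
            (finCongr h'))).domDomCongr (finCongr h) else 0) else 0) := by
    intro x hx
    have h : x.1 + x.2 = n := mem_antidiagonal.1 hx
    simp only [dif_pos h, wedgeG_apply, wedge_finset_sum, domDomCongr_sum, wedge_dite, dite_domDomCongr]
  rw [sum_congr rfl hL, sum_congr rfl hR, sum_sigma', sum_sigma']
  refine sum_nbij' (fun z ↦ ⟨(z.2.1, z.2.2 + z.1.2), (z.2.2, z.1.2)⟩)
    (fun z ↦ ⟨(z.1.1 + z.2.1, z.2.2), (z.1.1, z.2.1)⟩) ?_ ?_ ?_ ?_ ?_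
  · rintro ⟨⟨p, c⟩, ⟨a, b⟩⟩ hz
    simp only [mem_sigma, mem_antidiagonal] at hz
    exact mem_sigma.2 ⟨mem_antidiagonal.2 (show a + (b + c) = n by omega),
      mem_antidiagonal.2 (show b + c = b + c by rfl)⟩
  · rintro ⟨⟨a, q⟩, ⟨b, c⟩⟩ hz
    simp only [mem_sigma, mem_antidiagonal] at hz
    exact mem_sigma.2 ⟨mem_antidiagonal.2 (show (a + b) + c = n by omega),
      mem_antidiagonal.2 (show a + b = a + b by rfl)⟩
  · rintro ⟨⟨p, c⟩, ⟨a, b⟩⟩ hz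
    simp only [mem_sigma, mem_antidiagonal] at hz
    obtain ⟨-, rfl⟩ := hz
    rfl
  · rintro ⟨⟨a, q⟩, ⟨b, c⟩⟩ hz
    simp only [mem_sigma, mem_antidiagonal] at hz
    obtain ⟨-, rfl⟩ := hz
    rfl
  · rintro ⟨⟨p, c⟩, ⟨a, b⟩⟩ hz
    simp only [mem_sigma, mem_antidiagonal] at hz
    obtain ⟨h, h'⟩ := hz
    have h₁ : a + (b + c) = n := by omega
    simp only [dif_pos h, dif_pos h', dif_pos h₁, dite_true]
    rw [domDomCongr_finCongr_wedge, domDomCongr_finCongr_trans,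
      ContinuousAlternatingMap.WedgeAssoc_holds ℝ V A (w a) (w' b) (w'' c), domDomCongr_finCongr_trans,
      wedge_domDomCongr_finCongr, domDomCongr_finCongr_trans]

/-- `1 * w = w`: the constant `0`-form `1` is a left unit (`constOfIsEmpty_one_wedge`). [cite: Warner1983, 2.6] -/
protected theorem one_mul (w : GForm V A) : (1 : GForm V A) * w = w := by
  funext n
  rw [mul_apply, sum_eq_single (0, n)]
  · rw [dif_pos (Nat.zero_add n), one_def, of_apply_self, constOfIsEmpty_one_wedge,
      domDomCongr_finCongr_trans, domDomCongr_finCongr_self]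
  · rintro ⟨p, q⟩ hx hne
    have h : p + q = n := mem_antidiagonal.1 hx
    have hp : p ≠ 0 := by
      rintro rfl
      exact hne (by rw [Nat.zero_add] at h; rw [h])
    rw [dif_pos h, one_def, of_apply_of_ne hp, zero_wedge, ContinuousAlternatingMap.domDomCongr_zero]
  · exact fun h ↦ absurd (mem_antidiagonal.2 (Nat.zero_add n)) h

/-- `w * 1 = w`: the constant `0`-form `1` is a right unit (graded commutativity `WedgeComm_holds` and
`constOfIsEmpty_one_wedge`). [cite: Warner1983, 2.6] -/
protected theorem mul_one (w : GForm V A) : w * (1 : GForm V A) = w := by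
  funext n
  rw [mul_apply, sum_eq_single (n, 0)]
  · rw [dif_pos (Nat.add_zero n), one_def, of_apply_self,
      ContinuousAlternatingMap.WedgeComm_holds ℝ V A
        (ContinuousAlternatingMap.constOfIsEmpty ℝ V (Fin 0) (1 : A)) (w n),
      zero_mul, pow_zero, one_smul, constOfIsEmpty_one_wedge, domDomCongr_finCongr_trans,
      domDomCongr_finCongr_trans, domDomCongr_finCongr_self]
  · rintro ⟨p, q⟩ hx hne
    have h : p + q = n := mem_antidiagonal.1 hx
    have hq : q ≠ 0 := by
      rintro rfl
      exact hne (by rw [Nat.add_zero] at h; rw [h])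
    rw [dif_pos h, one_def, of_apply_of_ne hq, wedge_zero, ContinuousAlternatingMap.domDomCongr_zero]
  · exact fun h ↦ absurd (mem_antidiagonal.2 (Nat.add_zero n)) h

/-- **The ring of graded forms** `(GForm V A, +, ∧)`: the exterior algebra of `A`-valued continuous
alternating forms on `V`, all degrees at once. [cite: Warner1983, 2.6] -/
instance instRing : Ring (GForm V A) :=
  { (inferInstance : AddCommGroup (GForm V A)), instMul, instOne with
    mul_assoc := wedgeG_assoc
    one_mul := GForm.one_mul
    mul_one := GForm.mul_one
    left_distrib := wedgeG_add_right
    right_distrib := wedgeG_add_left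
    zero_mul := wedgeG_zero_left
    mul_zero := wedgeG_zero_right }

/-- **`GForm V A` is an `ℝ`-algebra**: real scalars pass through both factors of `∧`. [cite: Warner1983, 2.6] -/
instance instAlgebra : Algebra ℝ (GForm V A) :=
  Algebra.ofModule (fun c w w' ↦ wedgeG_smul_left c w w') (fun c w w' ↦ wedgeG_smul_right c w w')

/-- **`GForm V ℂ` is a `ℂ`-algebra**: complex scalars pass through both factors of `∧`. [cite: Warner1983, 2.6] -/
instance instAlgebraComplex : Algebra ℂ (GForm V ℂ) :=
  Algebra.ofModule (fun c w w' ↦ wedgeG_smul_left_complex c w w')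
    (fun c w w' ↦ wedgeG_smul_right_complex c w w')

/-- Real scalars pass through the left factor: `(c • w) * w' = c • (w * w')`. [cite: Warner1983, 2.6] -/
theorem smul_mul (c : ℝ) (w w' : GForm V A) : (c • w) * w' = c • (w * w') := wedgeG_smul_left c w w'

/-- Real scalars pass through the right factor: `w * (c • w') = c • (w * w')`. [cite: Warner1983, 2.6] -/
theorem mul_smul (c : ℝ) (w w' : GForm V A) : w * (c • w') = c • (w * w') := wedgeG_smul_right c w w'

/-! ### The parity operator is a ring automorphism -/

/-- `negDeg` is additive (the parity automorphism `(-1)^p` on `p`-forms is linear). [cite: Warner1983, 2.6 / 2.11] -/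
theorem negDeg_add (w w' : GForm V A) : negDeg (w + w') = negDeg w + negDeg w' := by
  funext m
  simp only [negDeg_apply, Pi.add_apply, smul_add]

/-- `negDeg 0 = 0`. [cite: Warner1983, 2.6 / 2.11] -/
@[simp]
theorem negDeg_zero : negDeg (0 : GForm V A) = 0 := by
  funext m
  simp only [negDeg_apply, Pi.zero_apply, smul_zero]

/-- `negDeg` commutes with real scalars. [cite: Warner1983, 2.6 / 2.11] -/
theorem negDeg_smul (c : ℝ) (w : GForm V A) : negDeg (c • w) = c • negDeg w := by
  funext m
  simp only [negDeg_apply, Pi.smul_apply, smul_comm c]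

/-- `negDeg 1 = 1` (the unit has degree `0`). [cite: Warner1983, 2.6 / 2.11] -/
@[simp]
theorem negDeg_one : negDeg (1 : GForm V A) = 1 := by
  rw [one_def, negDeg_of, pow_zero, one_smul]

/-- **`negDeg (w * w') = negDeg w * negDeg w'`**: the parity operator is multiplicative
(`(-1)^{p+q} = (-1)^p (-1)^q` on the summand `w_p ∧ w'_q`). [cite: Warner1983, 2.6] -/
theorem negDeg_mul (w w' : GForm V A) : negDeg (w * w') = negDeg w * negDeg w' := by
  funext n
  rw [negDeg_apply, mul_apply, mul_apply, smul_sum]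
  refine sum_congr rfl fun x hx ↦ ?_
  have h : x.1 + x.2 = n := mem_antidiagonal.1 hx
  rw [dif_pos h, dif_pos h, negDeg_apply, negDeg_apply, wedge_smul_left, wedge_smul_right, smul_smul,
    domDomCongr_finCongr_smul, show ((-1 : ℝ) ^ n) = (-1) ^ x.1 * (-1) ^ x.2 by rw [← pow_add, h]]

/-- The parity operator as a ring homomorphism `GForm V A →+* GForm V A` (the automorphism `(-1)^p` on
`p`-forms of the exterior algebra). [cite: Warner1983, 2.6 / 2.11] -/
def negDegRingHom : GForm V A →+* GForm V A where
  toFun := negDeg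
  map_one' := negDeg_one
  map_mul' := negDeg_mul
  map_zero' := negDeg_zero
  map_add' := negDeg_add

/-- The ring homomorphism `negDegRingHom` is `negDeg`. [cite: Warner1983, 2.6 / 2.11] -/
@[simp]
theorem coe_negDegRingHom : ⇑(negDegRingHom (V := V) (A := A)) = negDeg := rfl

/-- `negDeg` of a product of a list is the product of the `negDeg`s. [cite: Warner1983, 2.6 / 2.11] -/
theorem negDeg_list_prod (L : List (GForm V A)) : negDeg L.prod = (L.map negDeg).prod := by
  have h := map_list_prod (negDegRingHom (V := V) (A := A)) L
  rwa [coe_negDegRingHom] at h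

/-! ### Graded commutativity -/

/-- **Graded commutativity of homogeneous elements**: `of l ψ * of k η = (-1)^{kl} • (of k η * of l ψ)`.
[cite: Warner1983, 2.6] -/
theorem of_mul_of_comm (k l : ℕ) (η : V [⋀^Fin k]→L[ℝ] A) (ψ : V [⋀^Fin l]→L[ℝ] A) :
    of l ψ * of k η = ((-1 : ℝ) ^ (k * l)) • (of k η * of l ψ) := by
  rw [of_mul_of, of_mul_of, ContinuousAlternatingMap.WedgeComm_holds ℝ V A η ψ, of_smul,
    of_domDomCongr_finCongr]

/-- **Graded commutativity against an arbitrary graded form**: `of k η * z = z^{(k)} * of k η` with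
`z^{(k)}_m = (-1)^{km} z_m` (termwise `WedgeComm_holds` on the antidiagonal, read through
`(p, q) ↦ (q, p)`). [cite: Warner1983, 2.6] -/
theorem of_mul_eq_twist_mul_of (k : ℕ) (η : V [⋀^Fin k]→L[ℝ] A) (z : GForm V A) :
    of k η * z = (fun m ↦ ((-1 : ℝ) ^ (k * m)) • z m) * of k η := by
  funext n
  rw [mul_apply, mul_apply, ← Nat.sum_antidiagonal_swap]
  refine sum_congr rfl ?_
  rintro ⟨p, q⟩ hx
  have h : p + q = n := mem_antidiagonal.1 hx
  have h' : q + p = n := by omega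
  dsimp only [Prod.swap_prod_mk]
  rw [dif_pos h', dif_pos h]
  by_cases hq : q = k
  · subst hq
    rw [of_apply_self, wedge_smul_left, ContinuousAlternatingMap.WedgeComm_holds ℝ V A η (z p), smul_smul,
      ← mul_pow, neg_one_mul, neg_neg, one_pow, one_smul, domDomCongr_finCongr_trans]
  · rw [of_apply_of_ne hq, zero_wedge, wedge_zero, ContinuousAlternatingMap.domDomCongr_zero,
      ContinuousAlternatingMap.domDomCongr_zero]

/-- **Homogeneous elements of even degree are central**: `of k η * z = z * of k η` for every graded form
`z` when `k` is even. [cite: Warner1983, 2.6] -/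
theorem of_mul_comm_of_even {k : ℕ} (hk : Even k) (η : V [⋀^Fin k]→L[ℝ] A) (z : GForm V A) :
    of k η * z = z * of k η := by
  rw [of_mul_eq_twist_mul_of]
  congr 1
  funext m
  rw [(hk.mul_right m).neg_one_pow, one_smul]

/-- Homogeneous elements of odd degree anticommute in the graded sense: `of k η * z = negDeg z * of k η`
for `k` odd. [cite: Warner1983, 2.6] -/
theorem of_mul_eq_negDeg_mul_of_odd {k : ℕ} (hk : Odd k) (η : V [⋀^Fin k]→L[ℝ] A) (z : GForm V A) :
    of k η * z = negDeg z * of k η := by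
  rw [of_mul_eq_twist_mul_of]
  congr 1
  funext m
  rw [negDeg_apply, pow_mul, hk.neg_one_pow]

/-! ### Homogeneity along products -/

namespace IsHomog

/-- `1` is homogeneous of degree `0` (the exterior algebra is graded, `1 ∈ Λ⁰`). [cite: Warner1983, 2.6] -/
theorem one : IsHomog 0 (1 : GForm V A) := IsHomog.of 0 _

/-- Degrees add under the product: `Λᵏ ∧ Λˡ ⊂ Λᵏ⁺ˡ`. [cite: Warner1983, 2.6] -/
theorem mul {k l : ℕ} {w w' : GForm V A} (h : IsHomog k w) (h' : IsHomog l w') :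
    IsHomog (k + l) (w * w') :=
  h.wedgeG h'

/-- The product of a list of homogeneous graded forms is homogeneous of the total degree. [cite: Warner1983, 2.6] -/
theorem list_prod {κ : Type*} (d : κ → ℕ) (f : κ → GForm V A) (l : List κ)
    (h : ∀ j ∈ l, IsHomog (d j) (f j)) : IsHomog ((l.map d).sum) ((l.map f).prod) := by
  induction l with
  | nil => simpa only [List.map_nil, List.sum_nil, List.prod_nil] using one
  | cons j l ih =>
    rw [List.map_cons, List.sum_cons, List.map_cons, List.prod_cons]
    exact (h j List.mem_cons_self).mul (ih fun i hi ↦ h i (List.mem_cons_of_mem j hi))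

/-- `negDeg` acts on a homogeneous graded form of degree `k` by the sign `(-1)^k`. [cite: Warner1983, 2.6 / 2.11] -/
theorem negDeg_eq {k : ℕ} {w : GForm V A} (h : IsHomog k w) : negDeg w = ((-1 : ℝ) ^ k) • w := by
  conv_lhs => rw [h.eq_of]
  rw [negDeg_of, ← h.eq_of]

/-- `negDeg` fixes homogeneous graded forms of even degree. [cite: Warner1983, 2.6 / 2.11] -/
theorem negDeg_eq_self_of_even {k : ℕ} {w : GForm V A} (h : IsHomog k w) (hk : Even k) : negDeg w = w := by
  rw [h.negDeg_eq, hk.neg_one_pow, one_smul]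

/-- **Homogeneous graded forms of even degree are central.** [cite: Warner1983, 2.6] -/
theorem mul_comm_of_even {k : ℕ} {w : GForm V A} (h : IsHomog k w) (hk : Even k) (z : GForm V A) :
    w * z = z * w := by
  rw [h.eq_of]
  exact of_mul_comm_of_even hk (w k) z

/-- Graded commutativity of two homogeneous graded forms: `w' * w = (-1)^{kl} • (w * w')`.
[cite: Warner1983, 2.6] -/
theorem mul_comm_sign {k l : ℕ} {w w' : GForm V A} (h : IsHomog k w) (h' : IsHomog l w') :
    w' * w = ((-1 : ℝ) ^ (k * l)) • (w * w') := by
  rw [h.eq_of, h'.eq_of]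
  exact of_mul_of_comm k l (w k) (w' l)

end IsHomog

/-- A sum of even numbers along a list is even. [folklore] -/
private theorem even_sum_map_of_forall {κ : Type*} (d : κ → ℕ) (l : List κ) (h : ∀ j ∈ l, Even (d j)) :
    Even ((l.map d).sum) := by
  induction l with
  | nil => simp
  | cons j l ih =>
    rw [List.map_cons, List.sum_cons]
    exact (h j List.mem_cons_self).add (ih fun i hi ↦ h i (List.mem_cons_of_mem j hi))

/-! ### Antiderivations and the iterated Leibniz rule -/

section Leibniz

variable (D : GForm V A → GForm V A)

/-- An antiderivation kills the unit: `D 1 = 0` (from `D (1 * 1) = D 1 * 1 + negDeg 1 * D 1`). It is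
enough to know the Leibniz rule on the homogeneous pair `(1, 1)`. [cite: Warner1983, 2.11] -/
theorem apply_one_of_leibniz
    (hD : D ((1 : GForm V A) * 1) = D 1 * 1 + negDeg (1 : GForm V A) * D 1) : D 1 = 0 := by
  rw [mul_one, mul_one, negDeg_one, one_mul] at hD
  have h2 : D 1 + D 1 = D 1 + 0 := by rw [add_zero]; exact hD.symm
  exact add_left_cancel h2

/-- **The iterated Leibniz rule for an antiderivation**: if `D (w * w') = D w * w' + negDeg w * D w'`
for all graded forms, then for the product `w₁ ⋯ w_r = (l.map f).prod` of a family along an index list,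
`D (w₁ ⋯ w_r) = ∑_i negDeg (w₁ ⋯ w_{i-1}) * D w_i * (w_{i+1} ⋯ w_r)`. [cite: Warner1983, 2.11] -/
theorem apply_list_prod_of_leibniz (hD : ∀ w w' : GForm V A, D (w * w') = D w * w' + negDeg w * D w')
    {κ : Type*} (f : κ → GForm V A) (l : List κ) :
    D ((l.map f).prod) = ∑ i : Fin l.length,
      negDeg (((l.take i).map f).prod) * D (f l[i]) * ((l.drop (i + 1)).map f).prod := by
  induction l with
  | nil =>
    rw [List.map_nil, List.prod_nil, apply_one_of_leibniz D (hD 1 1)]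
    exact (sum_eq_zero fun i _ ↦ i.elim0).symm
  | cons j l ih =>
    rw [List.map_cons, List.prod_cons, hD, ih, mul_sum]
    simp only [List.length_cons]
    rw [Fin.sum_univ_succ]
    simp only [Fin.val_zero, List.take_zero, List.map_nil, List.prod_nil, negDeg_one,
      one_mul, Fin.getElem_fin, List.getElem_cons_zero, zero_add, Fin.val_succ, List.take_succ_cons, List.map_cons, List.prod_cons, List.getElem_cons_succ,
      List.drop_succ_cons, List.drop_zero, negDeg_mul]
    refine congrArg _ (sum_congr rfl fun i _ ↦ ?_)
    rw [mul_assoc, mul_assoc, mul_assoc]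

/-- **The iterated Leibniz rule, homogeneous factors**: the same identity for a family of homogeneous
graded forms `f j` of degrees `d j`, assuming the Leibniz rule only on pairs of homogeneous graded
forms. [cite: Warner1983, 2.11] -/
theorem apply_list_prod_of_leibniz_of_isHomog
    (hD : ∀ {k m : ℕ} {u v : GForm V A}, IsHomog k u → IsHomog m v →
      D (u * v) = D u * v + negDeg u * D v)
    {κ : Type*} (d : κ → ℕ) (f : κ → GForm V A) (l : List κ) (hf : ∀ j ∈ l, IsHomog (d j) (f j)) :
    D ((l.map f).prod) = ∑ i : Fin l.length,
      negDeg (((l.take i).map f).prod) * D (f l[i]) * ((l.drop (i + 1)).map f).prod := by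
  induction l with
  | nil =>
    rw [List.map_nil, List.prod_nil, apply_one_of_leibniz D (hD IsHomog.one IsHomog.one)]
    exact (sum_eq_zero fun i _ ↦ i.elim0).symm
  | cons j l ih =>
    have hl : ∀ i ∈ l, IsHomog (d i) (f i) := fun i hi ↦ hf i (List.mem_cons_of_mem j hi)
    rw [List.map_cons, List.prod_cons, hD (hf j List.mem_cons_self) (IsHomog.list_prod d f l hl), ih hl,
      mul_sum]
    simp only [List.length_cons]
    rw [Fin.sum_univ_succ]
    simp only [Fin.val_zero, List.take_zero, List.map_nil, List.prod_nil, negDeg_one,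
      one_mul, Fin.getElem_fin, List.getElem_cons_zero, zero_add, Fin.val_succ, List.take_succ_cons, List.map_cons, List.prod_cons, List.getElem_cons_succ,
      List.drop_succ_cons, List.drop_zero, negDeg_mul]
    refine congrArg _ (sum_congr rfl fun i _ ↦ ?_)
    rw [mul_assoc, mul_assoc, mul_assoc]

/-- **The iterated Leibniz rule for homogeneous factors of even degrees** (central, fixed by `negDeg`):
`D (w₁ ⋯ w_r) = ∑_i (w₁ ⋯ w̌_i ⋯ w_r) * D w_i`, the product with the `i`-th factor omitted being the
product along `l.eraseIdx i`. This is the shape of Lange's product rule for the endomorphisms attached to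
algebraic cycles (Lange 2023, Lemma 4.6.9), all of whose classes have even (co)degrees.
[cite: Warner1983, 2.11] [cite: Lange2023AbelianVarietiesComplex, §4.6.2 Lemma 4.6.9] -/
theorem apply_list_prod_of_leibniz_of_even
    (hD : ∀ {k m : ℕ} {u v : GForm V A}, IsHomog k u → IsHomog m v →
      D (u * v) = D u * v + negDeg u * D v)
    {κ : Type*} (d : κ → ℕ) (f : κ → GForm V A) (l : List κ) (hf : ∀ j ∈ l, IsHomog (d j) (f j))
    (hev : ∀ j ∈ l, Even (d j)) :
    D ((l.map f).prod) = ∑ i : Fin l.length, ((l.eraseIdx i).map f).prod * D (f l[i]) := by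
  rw [apply_list_prod_of_leibniz_of_isHomog D hD d f l hf]
  refine sum_congr rfl fun i _ ↦ ?_
  -- the prefix and the suffix are homogeneous of even degrees
  have htake : IsHomog (((l.take i).map d).sum) (((l.take i).map f).prod) :=
    IsHomog.list_prod d f _ fun j hj ↦ hf j (List.mem_of_mem_take hj)
  have hdrop : IsHomog (((l.drop (i + 1)).map d).sum) (((l.drop (i + 1)).map f).prod) :=
    IsHomog.list_prod d f _ fun j hj ↦ hf j (List.mem_of_mem_drop hj)
  have etake : Even (((l.take i).map d).sum) :=
    even_sum_map_of_forall d _ fun j hj ↦ hev j (List.mem_of_mem_take hj)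
  have edrop : Even (((l.drop (i + 1)).map d).sum) :=
    even_sum_map_of_forall d _ fun j hj ↦ hev j (List.mem_of_mem_drop hj)
  rw [htake.negDeg_eq_self_of_even etake, mul_assoc, ← hdrop.mul_comm_of_even edrop, ← mul_assoc,
    ← List.prod_append, ← List.map_append, ← List.eraseIdx_eq_take_drop_succ]

/-- The iterated Leibniz rule for homogeneous factors of even degrees, for an antiderivation in the full
sense (`D (w * w') = D w * w' + negDeg w * D w'` for all graded forms). [cite: Warner1983, 2.11] -/
theorem apply_list_prod_of_leibniz_of_even'
    (hD : ∀ w w' : GForm V A, D (w * w') = D w * w' + negDeg w * D w')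
    {κ : Type*} (d : κ → ℕ) (f : κ → GForm V A) (l : List κ) (hf : ∀ j ∈ l, IsHomog (d j) (f j))
    (hev : ∀ j ∈ l, Even (d j)) :
    D ((l.map f).prod) = ∑ i : Fin l.length, ((l.eraseIdx i).map f).prod * D (f l[i]) :=
  apply_list_prod_of_leibniz_of_even D (fun _ _ ↦ hD _ _) d f l hf hev

end Leibniz

end GForm

end Literature.LinearAlgebra.Alternating

end
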